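import Summits.QuantumFields.BalabanUV.T4Continuum.Support.NE7SliceGreenFlatLocalised
import Summits.QuantumFields.BalabanUV.T4Continuum.Support.NE7ApeFlatSkeletonLocalised
import HarnessLib

/-!
# NE7ApeOfTorusRoadV2 — THE TORUS ROAD v2 END WITH THE LOCALISED SLICE SOLVER LETTER DISCHARGED: `hape` (= [Balaban1985Variational] Prop. 8) ⇐ PER PLAQUETTE a
# chart `A` (skew periodic; sup `α₀`, lattice gradient `α₁`, coarse curl `ĝ` of its linearised top average), a TWO-REGION criticality defect of `e^{A}` on flat
# tangents (`τn` on the sites NEAR the plaquette's block, `τf` on the sites whose block is at torus block-distance `≥ ℓ + nbRad + 1` — the shell), a unitary gauge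
# matching `U` to `e^{A}` on the plaquette, and ONE numeric line `K·M·((τn + ρ) + e^{−cℓ}(τf + ρ)) + card n·(C_H∕M)(ĝ∕M) + 28α₀² ≤ (c₀ + θr)∕M²` — `K, c` on
# `d, L, card n` only; NO solver letter, NO lift letter, NO flat reference among the hypotheses

Cell `pub-balaban`, rung (B)+1 sub-cell t4, lineage `b2b-balaban-t4-ne7-p1` (CRUX PROVER NE7 #1 = OWNER of row NE7), generation 89; memo
`t4/b2b-balaban-t4-ne7-p1-g89/COSTING-N1.md` §3–§5.  File F255 (over F252 `NE7ApeFlatSkeletonLocalised.hape_of_torusRoadLocalised` and F254d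
`NE7SliceGreenFlatLocalised.sliceGreen_flat_localised` — G♭-loc, this generation's kernel theorem over GAN24's (1.110) decay and lit-balaban's `H_k` decay).

WHY.  F252 displayed the torus road v2 with the LOCALISED solver letter as a per-plaquette hypothesis; F253a∕b (torus core) and F254a–d (T4 reading) PROVE that letter
with `K_G = K·L^{k+1}`, `ϵ = e^{−cℓ}` for the canonical regions around the plaquette's block.  THIS FILE plugs it in: the near region is «all sites of the period box
whose block is within `ℓ + nbRad + 1` of the plaquette's block» and the far region its complement in the period box (so they cover), both written out as filters — the
consumer's shell commutators live in the far region once the cutoff radius exceeds `ℓ + nbRad + 1` blocks, and are discounted by `e^{−cℓ}`.  What the END still asks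
is exactly: (N1)-weak the local chart ([B8] Thm 2 TYPE at `U₀ = 1`, sup∕gradient constants of ANY size — memo §2), (N2) the two-region defect assembly (§4 of the memo),
(N3)′ the coarse-curl bound `ĝ`, and the numeric line.
WHAT ([folklore] composition; 0 def, 0 sorry; dimension `d + 1 ≥ 2`, `L ≥ 2`).  **`hape_of_torusRoadV2`** (statement in the title and the docstring).
HONEST FRAMING (page 1): composition BY NAME of tree theorems; the per-plaquette bundle is a HYPOTHESIS asserted for nothing; (N1)-weak, (N2), (N3)′ are NOT in the tree;
the normal part's row is the GLOBAL (R7♭) ((R7♭)-loc is a successor file); nothing of Bałaban's asserted; NOT (APE), NOT ONE-STEP, NOT NE7; spine 0∕9; finite T⁴ rung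
(B)+1 — NOT infinite volume, NOT mass gap, NOT `BetaPertH`, NOT Clay.  Continuum YM on T⁴ ⇐ BetaPertH ∧ nine spine estimates (0/9 proved); BetaPertH ⇐ (D1) ∧ (D4) ∧
CAP+tail; G-an2-4 gates asym, D1 and NE2/3/4.
-/

set_option autoImplicit false

open scoped BigOperators Matrix.Norms.L2Operator
open NormedSpace Finset Set

namespace Summit.QuantumFields.BalabanUV.T4Continuum.NE7ApeOfTorusRoadV2

open Literature.MathematicalPhysics.QuantumFieldTheory.Balaban1983to89
open B7Prop1Explicit B7Prop2Explicit MatrixLog UnitaryModel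
open T4AveragingDeficitWall (IsUnitaryCfg IsSkewDir SmallField vary curlAt dirL1)
open T4AveragingDeficitWallBoundary (IsPeriodicCfg periodBox)
open AveragingDeficitPeriodicCounting (IsPeriodicDir)
open AveragingDeficitMultiLevelPrep (TangentIter)
open MinimalActionLevels (perWin)
open MinimalActionSandwich (admissible)
open MinimalActionRate (sfClass)
open BlockAveragePushDirSplit (flat)
open BlockAverageVaryHolo (nbRad)
open B4Sect5Proof (latticeConst)
open B4TorusKernel.MultiPeriod (torusSupNorm)
open B5Prop11Plancherel (Tor fine)
open B5Hk163Strip (kappa163)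
open B5Hk163TorusHolderDecay (CdecD)
open B6LowerBound2153Torus (toT rep)
open NE3HessForm (hess dAction)
open NE3TangentCovariantTower (dirIter)
open NE3EnergyShapes (IsUnitarySite)
open NE7ApeFlatSkeletonLocalised (hape_of_torusRoadLocalised)
open NE7SliceGreenFlatLocalised (sliceGreen_flat_localised)

noncomputable section

variable {d : ℕ} {n : Type*} [Fintype n] [DecidableEq n]

/-- **`hape` ⇐ THE PER-PLAQUETTE BUNDLE OF THE TORUS ROAD v2, SOLVER LETTER DISCHARGED** (dimension `d + 1 ≥ 2`, `L ≥ 2`).  `∃ K ≥ 0, c > 0` (on `d, L, card n`) such that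
for every `N ≥ 1`, `c₀ ≥ 0`, `0 ≤ θ < 1`, `c₀ + θδ ≤ δ`, `δ₁ > c₀∕(1−θ)`: if for every datum of `𝒟_β`, level `k+1`, admissible tangent-critical `U` with `SmallField U (r∕M²)`,
`0 ≤ r ≤ δ`, and every plaquette `(z; μ ≠ ν)` there are `A α₀ α₁ τn τf ĝ ℓ u` with: the chart letters; the TWO-REGION defect letter on skew periodic flat tangents, the
near region being the sites of `[0, N·L^{k+1})^{d+1}` whose block is within torus block-distance `< ℓ + nbRad + 1` of the block of `z` and the far region the rest; the
gauge matching on the four bonds; and the numeric line of the title — then F31's `hape` holds for `δ₁`. [cite: Balaban1985Variational, Prop. 8 p.304] -/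
theorem hape_of_torusRoadV2 [Nonempty n] (hd : 1 ≤ d) {L : ℕ} [NeZero L] (hL : 2 ≤ L) :
    ∃ K c : ℝ, 0 ≤ K ∧ 0 < c ∧ ∀ (N : ℕ) [NeZero N] (ε δ δ₁ β c₀ θ : ℝ), 0 ≤ c₀ → 0 ≤ θ → θ < 1 → c₀ + θ * δ ≤ δ → c₀ / (1 - θ) < δ₁ →
    (∀ D : Site (d + 1) → Fin (d + 1) → (Matrix n n ℂ)ˣ, IsUnitaryCfg D → IsPeriodicCfg D (N : ℤ) → SmallField D (4 * (Real.exp β - 1)) →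
      ∀ (k : ℕ), ∀ U ∈ admissible (sfClass (d + 1) L N ε) L (k + 1) D,
      (∀ φ : Site (d + 1) → Fin (d + 1) → Matrix n n ℂ, IsSkewDir φ → IsPeriodicDir φ ((N * L ^ (k + 1) : ℕ) : ℤ) → TangentIter L k U φ →
        dAction U φ (perWin (d + 1) (N * L ^ (k + 1))) = 0) →
      ∀ r : ℝ, 0 ≤ r → r ≤ δ → SmallField U (r / ((L : ℝ) ^ (k + 1)) ^ 2) →
      ∀ (z : Site (d + 1)) (μ ν : Fin (d + 1)), μ ≠ ν →
        ∃ (A : Site (d + 1) → Fin (d + 1) → Matrix n n ℂ) (α₀ α₁ τn τf g ℓ : ℝ) (u : Site (d + 1) → (Matrix n n ℂ)ˣ),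
          -- the chart, cut off ((N1)-weak + cutoff)
          (IsSkewDir A ∧ IsPeriodicDir A ((N * L ^ (k + 1) : ℕ) : ℤ) ∧ 0 ≤ α₀ ∧ 0 ≤ α₁ ∧ (∀ y κ, ‖A y κ‖ ≤ α₀) ∧
            (∀ (y : Site (d + 1)) (κ τ' : Fin (d + 1)), ‖A (y + e τ') κ - A y κ‖ ≤ α₁) ∧
            (∀ (y : Site (d + 1)) (μ' ν' : Fin (d + 1)),
              ‖curlAt (flat (d := d + 1) (n := n)) (dirIter L (k + 1) (flat (d := d + 1) (n := n)) A) y μ' ν'‖ ≤ g)) ∧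
          -- the two-region criticality defect ((N2)): near = blocks within `ℓ + nbRad + 1` of the plaquette's block, far = the rest of the period box
          (0 ≤ τn ∧ 0 ≤ τf ∧ ∀ Y : Site (d + 1) → Fin (d + 1) → Matrix n n ℂ, IsSkewDir Y → IsPeriodicDir Y ((N * L ^ (k + 1) : ℕ) : ℤ) →
            dirIter L (k + 1) (flat (d := d + 1) (n := n)) Y = 0 →
            |dAction (vary (flat (d := d + 1) (n := n)) A 1) Y (perWin (d + 1) (N * L ^ (k + 1)))|
              ≤ τn * dirL1 Y ((periodBox (d := d + 1) (N * L ^ (k + 1))).filter (fun x => ¬ (ℓ + nbRad (d + 1) L + 1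
                    ≤ torusSupNorm (fun _ : Fin (d + 1) => N) ((fun i => x i / ((L ^ (k + 1) : ℕ) : ℤ))
                        - rep (fun _ : Fin (d + 1) => N) (B5Blocks16.blockOf (L ^ (k + 1)) (fun _ : Fin (d + 1) => N)
                            (toT (fine (L ^ (k + 1)) (fun _ : Fin (d + 1) => N)) z))))))
                + τf * dirL1 Y ((periodBox (d := d + 1) (N * L ^ (k + 1))).filter (fun x => ℓ + nbRad (d + 1) L + 1
                    ≤ torusSupNorm (fun _ : Fin (d + 1) => N) ((fun i => x i / ((L ^ (k + 1) : ℕ) : ℤ))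
                        - rep (fun _ : Fin (d + 1) => N) (B5Blocks16.blockOf (L ^ (k + 1)) (fun _ : Fin (d + 1) => N)
                            (toT (fine (L ^ (k + 1)) (fun _ : Fin (d + 1) => N)) z)))))) ∧
          -- the gauge matching `U` to `e^{A}` on the four bonds of the plaquette
          (IsUnitarySite u ∧ gaugeAct u U z μ = vary (flat (d := d + 1) (n := n)) A 1 z μ ∧
            gaugeAct u U (z + e μ) ν = vary (flat (d := d + 1) (n := n)) A 1 (z + e μ) ν ∧
            gaugeAct u U (z + e ν) μ = vary (flat (d := d + 1) (n := n)) A 1 (z + e ν) μ ∧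
            gaugeAct u U z ν = vary (flat (d := d + 1) (n := n)) A 1 z ν) ∧
          -- the numeric line
          K * (L : ℝ) ^ (k + 1) * ((τn + ((Fintype.card (T4AveragingDeficitWall.Plane (d + 1)) : ℝ)
              * (2 * (8 * α₀ * (2 * α₁ + 28 * α₀ ^ 2) + 6 * (Real.exp α₀ - 1) * (2 * α₁ + 24 * (Real.exp α₀ - 1) * α₀)
                  + (2 * α₁ + 24 * (Real.exp α₀ - 1) * α₀) * (2 * α₁ + 28 * α₀ ^ 2) + 960 * (Real.exp α₀ - 1) * α₀ ^ 2)
                + 64 * α₀ * α₁)))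
              + Real.exp (-(c * ℓ)) * (τf + ((Fintype.card (T4AveragingDeficitWall.Plane (d + 1)) : ℝ)
              * (2 * (8 * α₀ * (2 * α₁ + 28 * α₀ ^ 2) + 6 * (Real.exp α₀ - 1) * (2 * α₁ + 24 * (Real.exp α₀ - 1) * α₀)
                  + (2 * α₁ + 24 * (Real.exp α₀ - 1) * α₀) * (2 * α₁ + 28 * α₀ ^ 2) + 960 * (Real.exp α₀ - 1) * α₀ ^ 2)
                + 64 * α₀ * α₁))))
            + Fintype.card n * ((2 * (CdecD d * (((d : ℝ) + 1) * (2 * ((d : ℝ) + 1))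
              * ((2 + 32 / (kappa163 (d + 1) / (d + 1)) ^ 2) * latticeConst (d + 1) (kappa163 (d + 1) / (d + 1) / 2)))))
              / ((L ^ (k + 1) : ℕ) : ℝ) * (g / ((L ^ (k + 1) : ℕ) : ℝ)))
            + 28 * α₀ ^ 2 ≤ (c₀ + θ * r) / ((L : ℝ) ^ (k + 1)) ^ 2) →
    ∀ D : Site (d + 1) → Fin (d + 1) → (Matrix n n ℂ)ˣ, IsUnitaryCfg D → IsPeriodicCfg D (N : ℤ) → SmallField D (4 * (Real.exp β - 1)) →
      ∀ (k : ℕ), ∀ U ∈ admissible (sfClass (d + 1) L N ε) L (k + 1) D, SmallField U (δ / ((L : ℝ) ^ (k + 1)) ^ 2) →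
      (∀ φ : Site (d + 1) → Fin (d + 1) → Matrix n n ℂ, IsSkewDir φ → IsPeriodicDir φ ((N * L ^ (k + 1) : ℕ) : ℤ) → TangentIter L k U φ →
        dAction U φ (perWin (d + 1) (N * L ^ (k + 1))) = 0) → SmallField U (δ₁ / ((L : ℝ) ^ (k + 1)) ^ 2) := by
  classical
  obtain ⟨K, c, hK, hc, hG⟩ := sliceGreen_flat_localised (n := n) hd hL
  refine ⟨K, c, hK, hc, ?_⟩
  intro N _ ε δ δ₁ β c₀ θ hc₀ hθ0 hθ1 hcδ hδ₁ hloc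
  have hL1 : 1 ≤ L := by omega
  refine hape_of_torusRoadLocalised (d := d) (n := n) hL1 hc₀ hθ0 hθ1 hcδ hδ₁ ?_
  intro D hDu hDP hDs k U hU hcrit r hr0 hrδ hUr z μ ν hμν
  obtain ⟨A, α₀, α₁, τn, τf, g, ℓ, u, hchart, hdef, hgauge, hline⟩ := hloc D hDu hDP hDs k U hU hcrit r hr0 hrδ hUr z μ ν hμν
  haveI : NeZero (L ^ (k + 1)) := ⟨pow_ne_zero _ (by omega)⟩
  have hmc : N * L ^ (k + 1) = L ^ (k + 1) * N := Nat.mul_comm _ _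
  -- the plaquette's block and the two regions
  set y₀ : Tor (fun _ : Fin (d + 1) => N) :=
    B5Blocks16.blockOf (L ^ (k + 1)) (fun _ : Fin (d + 1) => N) (toT (fine (L ^ (k + 1)) (fun _ : Fin (d + 1) => N)) z) with hy₀
  set Bf : Finset (Site (d + 1)) := (periodBox (d := d + 1) (N * L ^ (k + 1))).filter (fun x => ℓ + nbRad (d + 1) L + 1
      ≤ torusSupNorm (fun _ : Fin (d + 1) => N) ((fun i => x i / ((L ^ (k + 1) : ℕ) : ℤ)) - rep (fun _ : Fin (d + 1) => N) y₀)) with hBf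
  set Bn : Finset (Site (d + 1)) := (periodBox (d := d + 1) (N * L ^ (k + 1))).filter (fun x => ¬ (ℓ + nbRad (d + 1) L + 1
      ≤ torusSupNorm (fun _ : Fin (d + 1) => N) ((fun i => x i / ((L ^ (k + 1) : ℕ) : ℤ)) - rep (fun _ : Fin (d + 1) => N) y₀))) with hBn
  have hcover : periodBox (d := d + 1) (N * L ^ (k + 1)) ⊆ Bn ∪ Bf := by
    intro x hx
    rw [Finset.mem_union, hBn, hBf, Finset.mem_filter, Finset.mem_filter]
    by_cases h : ℓ + nbRad (d + 1) L + 1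
        ≤ torusSupNorm (fun _ : Fin (d + 1) => N) ((fun i => x i / ((L ^ (k + 1) : ℕ) : ℤ)) - rep (fun _ : Fin (d + 1) => N) y₀)
    · exact Or.inr ⟨hx, h⟩
    · exact Or.inl ⟨hx, h⟩
  have hBnP : Bn ⊆ periodBox (d := d + 1) (L ^ (k + 1) * N) := by rw [← hmc]; exact Finset.filter_subset _ _
  have hBfP : Bf ⊆ periodBox (d := d + 1) (L ^ (k + 1) * N) := by rw [← hmc]; exact Finset.filter_subset _ _
  have hBffar : ∀ x ∈ Bf, ℓ + nbRad (d + 1) L + 1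
      ≤ torusSupNorm (fun _ : Fin (d + 1) => N) ((fun i => x i / ((L ^ (k + 1) : ℕ) : ℤ)) - rep (fun _ : Fin (d + 1) => N) y₀) :=
    fun x hx => (Finset.mem_filter.mp hx).2
  -- the localised solver letter at this plaquette (F254d), period spelled `N·L^{k+1}`
  have hGloc : ∀ X : Site (d + 1) → Fin (d + 1) → Matrix n n ℂ, IsSkewDir X → IsPeriodicDir X ((N * L ^ (k + 1) : ℕ) : ℤ) →
      dirIter L (k + 1) (flat (d := d + 1) (n := n)) X = 0 → ∀ a b : ℝ, 0 ≤ a → 0 ≤ b →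
      (∀ Y : Site (d + 1) → Fin (d + 1) → Matrix n n ℂ, IsSkewDir Y → IsPeriodicDir Y ((N * L ^ (k + 1) : ℕ) : ℤ) →
        dirIter L (k + 1) (flat (d := d + 1) (n := n)) Y = 0 →
        |hess (flat (d := d + 1) (n := n)) X Y (perWin (d + 1) (N * L ^ (k + 1)))| ≤ a * dirL1 Y Bn + b * dirL1 Y Bf) →
      ‖curlAt (flat (d := d + 1) (n := n)) X z μ ν‖ ≤ K * (L : ℝ) ^ (k + 1) * (a + Real.exp (-(c * ℓ)) * b) := by
    intro X hXs hXP hXT a b ha hb hsrc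
    rw [hmc] at hXP hsrc
    exact hG k N y₀ ℓ X hXs hXP hXT Bn Bf hBnP hBfP hBffar a b ha hb hsrc z rfl μ ν
  exact ⟨A, α₀, α₁, τn, τf, g, u, Bn, Bf, Real.exp (-(c * ℓ)), K * (L : ℝ) ^ (k + 1), hchart, hdef, hgauge,
    ⟨(Real.exp_pos _).le, hcover, hGloc⟩, hline⟩

end

end Summit.QuantumFields.BalabanUV.T4Continuum.NE7ApeOfTorusRoadV2
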